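/-
Copyright (c) 2026 the pub-hodgecm-mathlib formalisation cell (harness21).  Prover seat hodgecm-mathlib-A-p19 (g27), 2026-09-02.  Road «S3-tree»∕«S3-ram» (LEAD F0P3a-plan (g12)
T11-41∕T11-52; owner p06 (g15)), row (e2) «P-2-ram», organ «(D2-β)-ram, part T: THE TRANSLATION THEOREM FOR THE TAME BIQUADRATIC, TORUS TYPE B» — the discharge of the
`htrans` binder of ★ p847219 `RationalGoodVectorRamifiedBaseLaw` for the type-B CM involution `s̃ ∘ ι′` of the unramified eigen-field.
-/
import Literature.NumberTheory.NumberFields.UnramifiedQuadraticDictionary        -- ★ part L (this seat): coordinates, `Fix ι′ = ι₁(F_v)`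
import HarnessLib

/-!
# The translation theorem for the tame biquadratic, type B: `y ∈ K^{s̃ι′}` is an `s̃ι′`-norm from `K` iff `y·ι′(y)` is an `s`-norm from `F_v`
# (Serre, *Local Fields* V §2–§3; XI §4 ∕ XIV §6 «norm limitation»)

Topic `NumberTheory/NumberFields`; namespace `Literature.NumberTheory.NumberFields`.  THEOREMS ONLY (no definition, no instance, no notation, no named fact, no `sorry`); kernel lane
`--supports stmt-HodgeConjecture-24833`.  Cell `pub/hodgecm-mathlib` (D-0151), crux H413; road «S3-tree», seeding wave «S3-ram», row (e2) «P-2-ram»; organ **«(D2-β)-ram, part T (type B)»**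
(this seat): in the frame of ★ `UnramifiedQuadraticDictionary` (`K = F_v(θ)`, `θ² = ι₁ d`, `d` a non-square unit with `s d = d`; `s̃` over `s`, `s̃θ = θ`; `ι′` over `id`, `ι′θ = −θ`;
`σ_K := s̃ ∘ ι′` the TYPE-B CM involution — `K ∕ K^{σ_K}` UNRAMIFIED) over a TAME-RAMIFIED base involution `s` of `F_v`, the dictionary hypothesis `htrans` of ★ p847219 for `σ_K`:
for `y ≠ 0` with `σ_K y = y`, **`(∃ b, b·σ_K b·y = 1) ↔ (∃ a, ι′a = a ∧ a·σ_K a·(y·ι′y) = 1)`** — «`y` is a norm from `K` to `K^{σ_K}` iff `N_{K^{σ_K}∕F_v^{s}}(y) = y·ι′y` is a norm from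
`F_v` to `F_v^{s}`», the norm-limitation ∕ translation law `N_{K∕K′}(K^×) = N_{K′∕F}⁻¹(N_{E∕F}(E^×))` for the biquadratic `K ⊃ K′ = K^{σ_K}, E = F_v ⊃ F = F_v^s`, proved BY HAND:
writing `y = ι₁p + ι₁q·θ` (`sp = p`, `sq = −q`), the valuations `|p|` (fixed: «even») and `|q|` (anti-fixed: «odd») never tie (`hfixval`), and
(i) if `|q| < |p|`: `y = ι₁p·(1 + ι₁(q∕p)θ)` is a `σ_K`-norm (`p ∈ N ∪ dN` by `hnormF`, `ι₁d` a `σ_K`-norm by `hηn`, fixed principal units of `K` are norms by `hnK`) and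
`y·ι′y = ι₁(p² − q²d) = ι₁(p·sp)·ι₁(1 − (q∕p)²d)` is a rational norm (`hprinc`); (ii) if `|p| < |q|`: `|y| = |ι₁q|` is not the square of a valuation of `K` (`hanti`) so `y` is no `σ_K`-norm,
and `y·ι′y = (q·sq)·d·(1 − p²∕(q²d))` would make `d` a norm (`hdnn`).  The six base hypotheses are discharged at a tame-ramified CM place by ★ `RamifiedPlaceUnitNorms` (U1)–(U3) and the
anti-fixed uniformiser; `hηn`, `hnK` by ★ part N `UnramifiedQuadraticDictionaryNorms`.  HONEST LABEL: HC_CM is proved only modulo the 2 remaining named inputs (hLiu418 24832, h413 24833)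
until rung 0 closes; local algebra, count-neutral.

* §1 `coord_of_map_comp_eq_self` (`σ_K y = y ⇒ sp = p, sq = −q`), `mul_map_iota_eq_toPlace` (`y·ι′y = ι₁(p² − q²d)`), `valued_toPlace_eq'`, valuation split.
* §2 **`exists_norm_comp_iff_exists_rational_norm_typeB`**.

## References
* [SerreLocalFields1979] J.-P. Serre, *Local Fields*, GTM 67 (1979): Ch. V §2 Prop. 3 (unramified norms), §3 Cor. 2 (tamely ramified norms), Ch. XI §4 and Ch. XIV §6 (norm groups of
  composite abelian extensions ∕ norm limitation).
* [Neukirch1999] J. Neukirch, *Algebraic Number Theory*, Grundlehren 322 (1999): Ch. V (1.2), Ch. IV (6.4)–(6.5) (translation of norm groups).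
-/

set_option autoImplicit false

noncomputable section

open NumberField IsDedekindDomain Polynomial
open scoped ValuativeRel
open Literature.NumberTheory.Automorphic Literature.NumberTheory.Automorphic.UnitaryGroup

namespace Literature.NumberTheory.NumberFields

variable {F : Type} (E : Type) [Field F] [NumberField F] [Field E] [NumberField E] [Algebra F E]
  (v : HeightOneSpectrum (𝓞 F)) (w : PlacesOver E v)

/-! ## §1 Coordinates of `σ_K`-fixed elements, `y·ι′y`, valuations -/

/-- **`σ_K y = y ⇒ sp = p`, `sq = −q`** for `y = ι₁p + ι₁qθ`, `σ_K = s̃∘ι′` (unique coordinates). [cite: SerreLocalFields1979, Ch. V §3] -/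
theorem coord_of_map_comp_eq_self (s : v.adicCompletion F →+* v.adicCompletion F) {θ : w.1.adicCompletion E}
    (huniq : ∀ z : w.1.adicCompletion E, ∃! pq : v.adicCompletion F × v.adicCompletion F, z = toPlace v w pq.1 + toPlace v w pq.2 * θ)
    (s' ι' : w.1.adicCompletion E →+* w.1.adicCompletion E) (hs' : ∀ x, s' (toPlace v w x) = toPlace v w (s x)) (hs'θ : s' θ = θ)
    (hι'ι : ∀ x, ι' (toPlace v w x) = toPlace v w x) (hι'θ : ι' θ = -θ)
    (p q : v.adicCompletion F) (hfix : (s'.comp ι') (toPlace v w p + toPlace v w q * θ) = toPlace v w p + toPlace v w q * θ) :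
    s p = p ∧ s q = -q := by
  have hσ : (s'.comp ι') (toPlace v w p + toPlace v w q * θ) = toPlace v w (s p) + toPlace v w (-(s q)) * θ := by
    rw [RingHom.comp_apply, map_add, map_mul, hι'ι, hι'ι, hι'θ, map_add, map_mul, map_neg, hs', hs', hs'θ, map_neg]; ring
  rw [hσ] at hfix
  obtain ⟨pq, -, hpq⟩ := huniq (toPlace v w p + toPlace v w q * θ)
  have h1 := hpq (s p, -(s q)) hfix.symm
  have h2 := hpq (p, q) rfl
  have h := h1.trans h2.symm
  simp only [Prod.mk.injEq] at h
  exact ⟨h.1, by linear_combination -h.2⟩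

/-- **`y·ι′y = ι₁(p² − q²d)`** for `y = ι₁p + ι₁qθ`, `θ² = ι₁d`. [cite: SerreLocalFields1979, Ch. V §2] -/
theorem mul_map_iota_eq_toPlace {θ : w.1.adicCompletion E} {d : v.adicCompletion F} (hθ : θ ^ 2 = toPlace v w d)
    (ι' : w.1.adicCompletion E →+* w.1.adicCompletion E) (hι'ι : ∀ x, ι' (toPlace v w x) = toPlace v w x) (hι'θ : ι' θ = -θ) (p q : v.adicCompletion F) :
    (toPlace v w p + toPlace v w q * θ) * ι' (toPlace v w p + toPlace v w q * θ) = toPlace v w (p ^ 2 - q ^ 2 * d) := by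
  rw [map_add, map_mul, hι'ι, hι'ι, hι'θ, map_sub, map_mul, map_pow, map_pow, ← hθ]; ring

/-! ## §2 The translation theorem, type B -/

/-- **TRANSLATION THEOREM FOR THE TAME BIQUADRATIC, TYPE B** (see the module docstring): for the type-B CM involution `σ_K = s̃∘ι′` of the unramified eigen-field `K = F_v(θ)` over a
tame-ramified base `(F_v, s)`, a non-zero `σ_K`-fixed `y` satisfies `(∃ b, b·σ_K b·y = 1) ↔ (∃ a, ι′a = a ∧ a·σ_K a·(y·ι′y) = 1)` — the `htrans` binder of ★
`SymmetricEigenframe.exists_norm_symmCriterion_iff_exists_rational_norm` (p847219).  Base hypotheses (discharged at a tame-ramified CM place): `hnormF` (`F_v^{s,×} = N ⊔ d·N`), `hprinc`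
(fixed principal units are norms), `hdnn` (`d ∉ N`), `hfixval` (fixed and anti-fixed valuations never tie), `hantisq` (an anti-fixed valuation is not the square of a valuation of `K`);
eigen-field hypotheses (★ part N): `hηn` (`ι₁d ∈ N_{σ_K}`), `hnK` (fixed units of `K` are `σ_K`-norms).
[cite: SerreLocalFields1979, Ch. V §2 Prop. 3, §3 Cor. 2; Ch. XIV §6] [cite: Neukirch1999, Ch. IV (6.4)–(6.5), Ch. V (1.2)] -/
theorem exists_norm_comp_iff_exists_rational_norm_typeB
    (s : v.adicCompletion F →+* v.adicCompletion F) (hss : ∀ x, s (s x) = x) {d : v.adicCompletion F} (hsd : s d = d) (hd0 : d ≠ 0)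
    (hnormF : ∀ f : v.adicCompletion F, f ≠ 0 → s f = f → ∃ z : v.adicCompletion F, z * s z * f = 1 ∨ z * s z * f = d)
    (hprinc : ∀ x : v.adicCompletion F, s x = x → Valued.v (x - 1) < 1 → ∃ z : v.adicCompletion F, z * s z = x)
    (hdnn : ¬ ∃ z : v.adicCompletion F, z * s z = d)
    (hfixval : ∀ p q : v.adicCompletion F, p ≠ 0 → q ≠ 0 → s p = p → s q = -q → Valued.v p ≠ Valued.v q)
    (hantisq : ∀ q : v.adicCompletion F, q ≠ 0 → s q = -q → ∀ z : w.1.adicCompletion E, Valued.v z ^ 2 ≠ Valued.v (toPlace v w q))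
    {θ : w.1.adicCompletion E} (hθ : θ ^ 2 = toPlace v w d)
    (hval : ∀ p q : v.adicCompletion F, Valued.v (toPlace v w p + toPlace v w q * θ) = max (Valued.v p) (Valued.v q))
    (huniq : ∀ z : w.1.adicCompletion E, ∃! pq : v.adicCompletion F × v.adicCompletion F, z = toPlace v w pq.1 + toPlace v w pq.2 * θ)
    (s' ι' : w.1.adicCompletion E →+* w.1.adicCompletion E) (hs' : ∀ x, s' (toPlace v w x) = toPlace v w (s x)) (hs'θ : s' θ = θ)
    (hι'ι : ∀ x, ι' (toPlace v w x) = toPlace v w x) (hι'θ : ι' θ = -θ)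
    (hs'v : ∀ z, Valued.v (s' z) = Valued.v z) (hι'v : ∀ z, Valued.v (ι' z) = Valued.v z)
    (hfixι : ∀ z : w.1.adicCompletion E, ι' z = z → ∃ x, toPlace v w x = z)
    (hηn : ∃ e : w.1.adicCompletion E, e * (s'.comp ι') e = toPlace v w d)
    (hnK : ∀ u : w.1.adicCompletion E, Valued.v u = 1 → (s'.comp ι') u = u → ∃ e : w.1.adicCompletion E, e * (s'.comp ι') e = u)
    (y : w.1.adicCompletion E) (hy : y ≠ 0) (hσy : (s'.comp ι') y = y) :
    (∃ b : w.1.adicCompletion E, b * (s'.comp ι') b * y = 1) ↔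
      ∃ a : w.1.adicCompletion E, ι' a = a ∧ a * (s'.comp ι') a * (y * ι' y) = 1 := by
  set ι := toPlace v w with hιdef
  set σK := s'.comp ι' with hσK
  -- `σ_K` on `ι₁(F_v)` is `ι₁ ∘ s`
  have hσι : ∀ x, σK (ι x) = ι (s x) := fun x => by rw [hσK, RingHom.comp_apply, hιdef, hι'ι, hs']
  -- valuations along `ι₁`
  have hιv : ∀ x, Valued.v (ι x) = Valued.v x := fun x => by
    have h := hval x 0
    rwa [map_zero, zero_mul, add_zero, map_zero, max_eq_left zero_le] at h
  have hι0 : ∀ {x}, ι x = 0 ↔ x = 0 := fun {x} => map_eq_zero_iff ι (toPlace v w).injective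
  have hθv : Valued.v θ = 1 := by
    have h := hval 0 1; rwa [map_zero, map_one, zero_add, one_mul, map_zero, map_one, max_eq_right zero_le] at h
  have hd1 : Valued.v d = 1 := by
    have h := congrArg Valued.v hθ
    rw [map_pow, hθv, one_pow, hιv] at h
    exact h.symm
  -- coordinates of `y`
  obtain ⟨⟨p, q⟩, hypq, -⟩ := huniq y
  simp only at hypq
  obtain ⟨hsp, hsq⟩ := coord_of_map_comp_eq_self E v w s huniq s' ι' hs' hs'θ hι'ι hι'θ p q (by rw [← hypq]; exact hσy)
  have hyι : y * ι' y = ι (p ^ 2 - q ^ 2 * d) := by rw [hypq]; exact mul_map_iota_eq_toPlace E v w hθ ι' hι'ι hι'θ p q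
  have hvy : Valued.v y = max (Valued.v p) (Valued.v q) := by rw [hypq, hval]
  -- rational norms are `ι₁(z·sz)`
  have hratnorm : ∀ z : v.adicCompletion F, ι z * σK (ι z) = ι (z * s z) := fun z => by rw [hσι, ← map_mul]
  -- the valuation split: `|q| < |p|` or `|p| < |q|`
  have hsplit : Valued.v q < Valued.v p ∨ Valued.v p < Valued.v q := by
    by_cases hp : p = 0
    · right
      rw [hp, map_zero]
      have hq : q ≠ 0 := fun hq => hy (by rw [hypq, hp, hq, map_zero, zero_mul, add_zero])
      exact (Valuation.pos_iff _).2 hq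
    by_cases hq : q = 0
    · left; rw [hq, map_zero]; exact (Valuation.pos_iff _).2 hp
    exact lt_or_gt_of_ne (hfixval p q hp hq hsp hsq).symm
  rcases hsplit with hlt | hlt
  · /- CASE (i): `|q| < |p|` — both sides hold -/
    have hp : p ≠ 0 := fun h0 => by rw [h0, map_zero] at hlt; exact (not_lt.2 zero_le) hlt
    have hιp : ι p ≠ 0 := fun h => hp (hι0.1 h)
    -- the fixed principal unit `u₁ = 1 + ι₁(q∕p)·θ` of `K` and `x₁ = 1 − (q∕p)²d` of `F_v`
    have hqp : Valued.v (q / p) < 1 := by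
      rw [map_div₀, div_eq_mul_inv]
      exact mul_inv_lt_of_lt_mul₀ (by rw [one_mul]; exact hlt)
    have hsmall : Valued.v (ι (q / p) * θ) < 1 := by
      have h := hval 0 (q / p)
      rw [map_zero, zero_add, map_zero, max_eq_right zero_le] at h
      rw [h]; exact hqp
    have hu₁v : Valued.v (1 + ι (q / p) * θ) = 1 := by
      have h := Valuation.map_add_eq_of_lt_left (Valued.v : Valuation (w.1.adicCompletion E) (WithZero (Multiplicative ℤ))) (x := (1 : w.1.adicCompletion E)) (y := ι (q / p) * θ)
        (by rw [map_one]; exact hsmall)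
      rwa [map_one] at h
    have hu₁fix : σK (1 + ι (q / p) * θ) = 1 + ι (q / p) * θ := by
      rw [map_add, map_one, map_mul, hσι, map_div₀, hsq, hsp, hσK, RingHom.comp_apply, hι'θ, map_neg, hs'θ, neg_div, map_neg]; ring
    obtain ⟨e₁, he₁⟩ := hnK _ hu₁v hu₁fix
    have he₁0 : e₁ ≠ 0 := fun h0 => by
      rw [h0, zero_mul] at he₁
      have := hu₁v; rw [← he₁, map_zero] at this; exact zero_ne_one this
    have hyfac : y = ι p * (1 + ι (q / p) * θ) := by rw [hypq, map_div₀]; field_simp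
    constructor
    · -- (⟹): the right side holds outright in this case
      intro _
      -- `x₁ = 1 − (q/p)² d` is a fixed principal unit, hence a norm `r·sr`
      have hx₁fix : s (1 - (q / p) ^ 2 * d) = 1 - (q / p) ^ 2 * d := by rw [map_sub, map_one, map_mul, map_pow, map_div₀, hsq, hsp, hsd, neg_div, neg_sq]
      have hx₁v : Valued.v ((1 - (q / p) ^ 2 * d) - 1) < 1 := by
        rw [show (1 - (q / p) ^ 2 * d) - 1 = -((q / p) ^ 2 * d) by ring, Valuation.map_neg, map_mul, map_pow]
        have hdv : Valued.v d ≤ 1 := hd1.le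
        calc Valued.v (q / p) ^ 2 * Valued.v d ≤ Valued.v (q / p) ^ 2 * 1 := mul_le_mul_right hdv _
          _ < 1 := by
            rw [mul_one, pow_two]
            exact lt_of_le_of_lt (by have h := mul_le_mul_right hqp.le (Valued.v (q / p)); rwa [mul_one] at h) hqp
      obtain ⟨r, hr⟩ := hprinc _ hx₁fix hx₁v
      have hr0 : r ≠ 0 := fun h0 => by
        rw [h0, zero_mul] at hr
        have h := hx₁v; rw [← hr, zero_sub, Valuation.map_neg, map_one] at h; exact lt_irrefl _ h
      have hsr : s r ≠ 0 := fun h0 => hr0 (by rw [← hss r, h0, map_zero])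
      have key : (p * r)⁻¹ * s ((p * r)⁻¹) * (p ^ 2 - q ^ 2 * d) = 1 := by
        have hr' : p ^ 2 * (r * s r) = p ^ 2 - q ^ 2 * d := by rw [hr]; field_simp
        rw [map_inv₀, map_mul, hsp, ← hr']
        field_simp
      refine ⟨ι (p * r)⁻¹, by rw [hιdef, hι'ι], ?_⟩
      rw [hyι, hratnorm, ← map_mul, key, map_one]
    · -- (⟸): the left side holds outright in this case
      intro _
      -- `ι p` is a `σ_K`-norm up to inversion: from `hnormF`
      have hpnorm : ∃ b₀ : w.1.adicCompletion E, b₀ * σK b₀ * ι p = 1 := by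
        obtain ⟨z, hz⟩ := hnormF p hp hsp
        rcases hz with h | h
        · exact ⟨ι z, by rw [hratnorm, ← map_mul, h, map_one]⟩
        · obtain ⟨e, he⟩ := hηn
          have he0 : e ≠ 0 := fun h0 => by rw [h0, zero_mul] at he; exact (hι0.not.2 hd0) he.symm
          refine ⟨ι z / e, ?_⟩
          have h' : ι z * σK (ι z) * ι p = e * σK e := by rw [hratnorm, ← map_mul, h]; exact he.symm
          have hσe : σK e ≠ 0 := fun h0 => by rw [h0, mul_zero] at he; exact (hι0.not.2 hd0) he.symm
          rw [map_div₀]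
          field_simp
          linear_combination h'
      obtain ⟨b₀, hb₀⟩ := hpnorm
      refine ⟨b₀ / e₁, ?_⟩
      have hσe₁ : σK e₁ ≠ 0 := fun h0 => by rw [h0, mul_zero] at he₁; rw [← he₁] at hu₁v; rw [map_zero] at hu₁v; exact zero_ne_one hu₁v
      have hu₁0 : (1 + ι (q / p) * θ) ≠ 0 := fun h0 => by rw [h0, map_zero] at hu₁v; exact zero_ne_one hu₁v
      have heq : b₀ / e₁ * σK (b₀ / e₁) * y = (b₀ * σK b₀ * ι p) * ((1 + ι (q / p) * θ) / (e₁ * σK e₁)) := by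
        rw [hyfac, map_div₀]
        field_simp
      rw [heq, hb₀, he₁, one_mul, div_self hu₁0]
  · /- CASE (ii): `|p| < |q|` — both sides fail -/
    have hq : q ≠ 0 := fun h0 => by rw [h0, map_zero] at hlt; exact (not_lt.2 zero_le) hlt
    have hvyq : Valued.v y = Valued.v (ι q) := by rw [hvy, max_eq_right hlt.le, hιv]
    constructor
    · rintro ⟨b, hb⟩
      exfalso
      have hvσb : Valued.v (σK b) = Valued.v b := by rw [hσK, RingHom.comp_apply, hs'v, hι'v]
      have h : Valued.v b ^ 2 * Valued.v y = 1 := by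
        have h := congrArg Valued.v hb
        rwa [map_mul, map_mul, map_one, hvσb, ← pow_two] at h
      have hb0 : Valued.v b ≠ 0 := fun h0 => by rw [h0, zero_pow two_ne_zero, zero_mul] at h; exact zero_ne_one h
      have hyv : Valued.v y = Valued.v b⁻¹ ^ 2 := by
        rw [map_inv₀, inv_pow]
        exact eq_inv_of_mul_eq_one_right h
      exact hantisq q hq hsq b⁻¹ (by rw [← hyv, hvyq])
    · rintro ⟨a, haι, ha⟩
      exfalso
      obtain ⟨a', rfl⟩ := hfixι a haι
      -- `a'·sa'·(p² − q²d) = 1` in `F_v`, and `p² − q²d = (q·sq)·d·x₂`, `x₂` a fixed principal unit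
      have h1 : a' * s a' * (p ^ 2 - q ^ 2 * d) = 1 := by
        apply (toPlace v w).injective
        rw [map_one, map_mul, ← hιdef, ← hratnorm a', ← hyι]
        exact ha
      have hx₂fix : s (1 - p ^ 2 / (q ^ 2 * d)) = 1 - p ^ 2 / (q ^ 2 * d) := by
        rw [map_sub, map_one, map_div₀, map_pow, map_mul, map_pow, hsp, hsq, hsd, neg_sq]
      have hx₂v : Valued.v ((1 - p ^ 2 / (q ^ 2 * d)) - 1) < 1 := by
        have hq2d : q ^ 2 * d ≠ 0 := mul_ne_zero (pow_ne_zero 2 hq) hd0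
        rw [show (1 - p ^ 2 / (q ^ 2 * d)) - 1 = -((p / q) ^ 2 / d) by field_simp; ring, Valuation.map_neg, map_div₀, map_pow, hd1, div_one]
        have hpq : Valued.v (p / q) < 1 := by
          rw [map_div₀, div_eq_mul_inv]
          exact mul_inv_lt_of_lt_mul₀ (by rw [one_mul]; exact hlt)
        rw [pow_two]
        exact lt_of_le_of_lt (by have h := mul_le_mul_right hpq.le (Valued.v (p / q)); rwa [mul_one] at h) hpq
      obtain ⟨r, hr⟩ := hprinc _ hx₂fix hx₂v
      apply hdnn
      refine ⟨(a' * q * r)⁻¹, ?_⟩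
      have h2 : p ^ 2 - q ^ 2 * d = -(q ^ 2 * d) * (r * s r) := by rw [hr]; field_simp; ring
      rw [h2] at h1
      -- `h1 : a'·sa'·(−(q²d)·(r·sr)) = 1`; the witness: `(a'qr)⁻¹·s((a'qr)⁻¹) = 1∕(a'sa'·q·(−q)·r sr) = d`
      have ha'0 : a' ≠ 0 := fun h0 => by rw [h0, zero_mul, zero_mul] at h1; exact zero_ne_one h1
      have hsa'0 : s a' ≠ 0 := fun h0 => ha'0 (by rw [← hss a', h0, map_zero])
      have hr0 : r ≠ 0 := fun h0 => by rw [h0, zero_mul, mul_zero, mul_zero] at h1; exact zero_ne_one h1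
      have hsr0 : s r ≠ 0 := fun h0 => hr0 (by rw [← hss r, h0, map_zero])
      rw [map_inv₀, map_mul, map_mul, hsq]
      field_simp
      linear_combination h1

end Literature.NumberTheory.NumberFields

end
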